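import Mathlib
import Summits.QuantumFields.YangMills.Theses.ThermodynamicCeilings

/-!
# Route `ThermodynamicCeilings` — the Assembly item

`Assembly : TopBandTransfer → LargeVolumeCalibration → TopBandCeilingC → ScaleMonotonicityC → SqrtDominationC → OnsetFloorsC → leaf`.
Proof: modus ponens — `TopBandTransfer` turns (K_M, the top-band ceiling, √-domination) into the large-volume factorial ceilings and
`LargeVolumeCalibration` turns those and the onset floors into the leaf.  This proves only the implication (the assembly), none of its
hypotheses; no summit / leaf / NT / UV / IR statement is proved here (D-0145 ideator ym-idea-11 g5, lens «wuc», LINE D).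
-/

set_option autoImplicit false

namespace Summit.QuantumFields.YangMills.Theses.ThermodynamicCeilings

/-- closes the assembly item of route `ThermodynamicCeilings`. -/
theorem assembly_proof : Assembly :=
  fun hTr hCal hTop hM hD hF => hCal (hTr hM hTop hD) hF

end Summit.QuantumFields.YangMills.Theses.ThermodynamicCeilings
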